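import Literature.NumberTheory.CubicFields.ThreeTorsionBridge
import Literature.NumberTheory.CubicFields.MaximalCubicRings
import Literature.NumberTheory.CubicFields.SubringForms
import Literature.NumberTheory.CubicFields.ReducibleMaximality
import HarnessLib

/-!
# Davenport–Heilbronn's first-order mean of `#Cl₃` (BST Cor. 7 / §8.5): reduction to the count of `GL₂(ℤ)`-orbits of irreducible binary cubic forms of fundamental discriminant

Topic `Literature/NumberTheory/CubicFields` × `QuadraticFields`. The named fact
`Literature.NumberTheory.QuadraticFields.davenportHeilbronn_threeTorsion_sum_asymp`
(`ThreeTorsionMean.lean`: `Σ_{-X<D<0} #Cl₃(D) ~ (6/π²) X`, `Σ_{0<D<X} #Cl₃(D) ~ (4/π²) X` over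
fundamental discriminants; Davenport–Heilbronn 1971 Thm 3 in the form of Bhargava–Shankar–Tsimerman,
§8.5) has the following PRINTED proof (BST arXiv:1005.0672, §8.5, proof of Cor. 7):

1. (sumh) `Σ_{0<±Disc(K₂)<X} (h₃*(K₂) − 1)/2 = N(𝒱 ∩ V^{(i)}; X)`: "by class field theory the number
   of triplets of cubic fields `K₃` corresponding to a given `K₂` … equals `(h₃*(K₂) − 1)/2`", the
   `K₃` being the nowhere totally ramified cubic fields, `Disc K₃ = Disc K₂`, and `N(𝒱 ∩ V^{(i)}; X)`
   the number of `GL₂(ℤ)`-orbits of irreducible integral binary cubic forms in `𝒱 = ∩_p 𝒱_p`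
   (maximal, nowhere totally ramified — BST §8.2: "`𝒵_p = V_ℤ − 𝒱_p` consists of those binary cubic
   forms whose discriminants are not fundamental") with `0 < (−1)^i Disc < X`;
2. `lim N(𝒱 ∩ V^{(i)}; X)/X = (π²/(12nᵢ)) Π_p (1 − p⁻²)² = 3/(nᵢπ²)` (`n₀ = 6`, `n₁ = 2`), "by the same
   argument as in the proof of the main term of Theorem 1" (Davenport's geometry-of-numbers count with
   congruence conditions, the uniformity estimate Prop. 23 and the sieve of §8.3);
3. `lim Σ_{0<±Disc(K₂)<X} 1 / X = 3/π²` ("it is known that");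
4. hence `Σ h₃* = Σ 1 + 2N ~ (3/π² + 6/(nᵢπ²)) X`.

This file PROVES steps 1 (its binary-cubic-form half), 3 and 4 on the tree's genuine objects, so
that the fact is reduced to exactly two inputs, each stated on tree objects: the class-field-theory
dictionary `#Cl₃(D) = 2·#{cubic fields of discriminant D} + 1` (the existing named fact
`threeTorsion_eq_two_mul_cubicFieldCountOfDisc_add_one` of `ThreeTorsionMeanDecomposition.lean`; the
hypotheses `hdict` below are VERBATIM its statement, so `(h : threeTorsion_eq_two_mul_cubicFieldCountOfDisc_add_one)`
is passed as `hdict` directly — that file is not imported only to keep this one low in the import graph)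
and the orbit count of step 2.

* `RingOfForm.isMaximal_of_isFundamental_disc` — **a binary cubic form of fundamental discriminant
  has maximal ring `R(f)`** (an overring of index `N` has `Disc f = N² Disc g`, and a square dividing
  a fundamental discriminant is `1` or `4`, the latter excluded by `Disc g ≡ 0, 1 (mod 4)`); so the
  forms "in `𝒱`" are simply the irreducible forms of fundamental discriminant;
* `irredOrbitsOfDisc D` — the `GL₂(ℤ)`-orbits of irreducible forms of discriminant exactly `D`, and
  **`cubicFieldCountOfDisc_eq_card_irredOrbitsOfDisc`** — for FUNDAMENTAL `D`, the number of cubic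
  fields of discriminant `D` (up to isomorphism) equals the number of these orbits (Delone–Faddeev /
  Davenport–Heilbronn: cubic fields ↔ orbits of irreducible maximal forms, `Disc` preserved; the tree's
  `CubicFieldCountForms.range_orbitOfClass` fibrewise), i.e. `N(𝒱 ∩ V^{(i)}; X) = Σ_{0<±D<X fund.}
  #irredOrbitsOfDisc D = Σ_{0<±D<X fund.} cubicFieldCountOfDisc D`;
* **`davenportHeilbronn_threeTorsion_sum_asymp_of_cubicFieldCount`** — steps 3–4: the dictionary and
  `Σ_{D ∈ negFundDiscrs X} cubicFieldCountOfDisc D / X → 3/(2π²)`,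
  `Σ_{D ∈ posFundDiscrs X} cubicFieldCountOfDisc D / X → 1/(2π²)` give the fact (with the PROVED count
  of quadratic fields `fundDiscrs_card_asymp_holds`: `2·3/(2π²) + 3/π² = 6/π²`, `2·1/(2π²) + 3/π² = 4/π²`);
* **`davenportHeilbronn_threeTorsion_sum_asymp_of_irredOrbitCount`** — the same with step 2 in BST's
  own language: `Σ_{D ∈ negFundDiscrs X} #irredOrbitsOfDisc D / X → 3/(2π²)` (`= 3/(n₁π²)`) and
  `Σ_{D ∈ posFundDiscrs X} #irredOrbitsOfDisc D / X → 1/(2π²)` (`= 3/(n₀π²)`);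
* `tendsto_cubicFieldCount_div_of_sum_asymp` — conversely the fact and the dictionary give back the two
  counts: given the dictionary, Cor. 7's sums and the counts of cubic fields of fundamental discriminant
  are equivalent (consistency of the vendored constants).

NOT here (the two remaining inputs, neither restated as a fact): the dictionary (class field theory,
Hasse; named fact elsewhere) and the orbit count of step 2 (Davenport 1951 / Davenport–Heilbronn 1971
§§2–5 / BST Thms 17, 20, Prop. 23; the sieve itself is the tree's
`DavenportHeilbronnSieve.tendsto_count_iInter_div`).

## References

* M. Bhargava, A. Shankar, J. Tsimerman, *On the Davenport–Heilbronn theorems and second order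
  terms*, Invent. Math. 193 (2013) 439–499 = arXiv:1005.0672, Cor. 7, §8.1, §8.2 (𝒱_p, 𝒵_p), §8.5
  (proof of Cor. 7: (sumh) and the two limits) [BhargavaShankarTsimerman2012].
* H. Davenport, H. Heilbronn, *On the density of discriminants of cubic fields. II*, Proc. Roy. Soc.
  London A 322 (1971) 405–420, Thm 3 and §6 [DavenportHeilbronn1971].
* M. Bhargava, T. Taniguchi, F. Thorne, Math. Ann. 389 (2024) = arXiv:2107.12819, p. 3 (cubic fields
  of fundamental discriminant `D` ↔ index-3 subgroups of `Cl(ℚ(√D))`) [BhargavaTaniguchiThorne2023].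
-/

noncomputable section

open Filter Finset
open scoped Topology

namespace Literature.NumberTheory.CubicFields

open NumberField BinaryCubic RingOfForm Literature.NumberTheory.QuadraticFields

/-! ### Forms of fundamental discriminant are maximal (`𝒱 ⊆ 𝒰`) -/

/-- **A binary cubic form whose discriminant is a fundamental discriminant has maximal ring `R(f)`**
(BST §8.2: the forms outside `𝒱_p` — non-maximal at `p`, or totally ramified at `p` — are "those
binary cubic forms whose discriminants are not fundamental" at `p`; here the global consequence
needed for Cor. 7). Proof: a proper overring `R(f) ↪ R(g)` of index `|N| > 1` gives
`Disc f = N² Disc g` (`disc_eq_detOnQuot_sq_mul`); a square dividing a fundamental discriminant is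
`1` or `4` (`Quadratic.sq_eq_one_or_four_of_sq_dvd`), and `Disc f = 4 Disc g` with
`Disc g ≡ 0, 1 (mod 4)` (`disc_emod_four`) is not fundamental.
[cite: BhargavaShankarTsimerman2012, §8.2 (𝒵_p = forms whose discriminant is not fundamental at p)] -/
theorem RingOfForm.isMaximal_of_isFundamental_disc {f : BinaryCubic ℤ}
    (hf : (f.disc % 4 = 1 ∧ Squarefree f.disc ∧ f.disc ≠ 1) ∨
      (4 ∣ f.disc ∧ (f.disc / 4 % 4 = 2 ∨ f.disc / 4 % 4 = 3) ∧ Squarefree (f.disc / 4))) :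
    IsMaximal f := by
  intro g φ hφ
  by_contra hns
  have hD : f.disc = detOnQuot φ ^ 2 * g.disc := disc_eq_detOnQuot_sq_mul φ hφ
  have hnu : ¬ IsUnit (detOnQuot φ) := fun hu => hns (surjective_of_isUnit_detOnQuot φ hu)
  rcases Quadratic.sq_eq_one_or_four_of_sq_dvd hf ⟨g.disc, hD⟩ with h1 | h4
  · exact hnu (isUnit_iff_exists_inv.mpr ⟨detOnQuot φ, by rw [← sq, h1]⟩)
  · rw [h4] at hD
    rcases hf with ⟨h1', -, -⟩ | ⟨-, hm, -⟩
    · omega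
    · rcases disc_emod_four g with h0 | h0 <;> omega

/-- Hence a form of fundamental discriminant lies in `U_p` for every prime `p` (indeed every `p > 1`).
[cite: BhargavaShankarTsimerman2012, §8.2 (𝒱_p ⊆ 𝒰_p)] -/
theorem BinaryCubic.memU_of_isFundamental_disc {f : BinaryCubic ℤ}
    (hf : (f.disc % 4 = 1 ∧ Squarefree f.disc ∧ f.disc ≠ 1) ∨
      (4 ∣ f.disc ∧ (f.disc / 4 % 4 = 2 ∨ f.disc / 4 % 4 = 3) ∧ Squarefree (f.disc / 4)))
    {p : ℕ} (hp : 1 < p) : f.MemU p :=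
  memU_of_isMaximal (RingOfForm.isMaximal_of_isFundamental_disc hf) hp

/-! ### Cubic fields of discriminant `D` and orbits of irreducible forms of discriminant `D` -/

/-- The `GL₂(ℤ)`-orbits of IRREDUCIBLE integral binary cubic forms of discriminant exactly `D`
(a subset of `orbitsOfDisc D`; for fundamental `D` these are the orbits counted by
`N(𝒱 ∩ V^{(i)}; X)` in BST §8.5). [cite: BhargavaShankarTsimerman2012, §8.5 (N(𝒱 ∩ V^{(i)}; X))] -/
def irredOrbitsOfDisc (D : ℤ) : Set (Set (BinaryCubic ℤ)) :=
  {O | ∃ f : BinaryCubic ℤ, O = gl2zOrbit f ∧ f.IsIrreducible ∧ f.disc = D}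

/-- The `GL₂(ℤ)`-orbit of forms attached to a cubic subfield of `ℂ` of discriminant `D`: the orbit of
any `f` with `R(f) ≅ 𝓞 K` (as `CubicFieldCount.orbitOfField`, fibrewise). [folklore] -/
def orbitOfFieldOfDisc {D : ℤ} (K : cubicSubfieldsOfDisc D) : Set (BinaryCubic ℤ) :=
  gl2zOrbit (exists_ringOfForm_ringEquiv_ringOfIntegers (K : FiniteSubfield) K.2.1).choose

/-- The chosen form of `K` has ring `𝓞 K`. [folklore] -/
theorem nonempty_ringEquiv_chosenFormOfDisc {D : ℤ} (K : cubicSubfieldsOfDisc D) :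
    Nonempty (RingOfForm (exists_ringOfForm_ringEquiv_ringOfIntegers (K : FiniteSubfield) K.2.1).choose
      ≃+* 𝓞 (K : FiniteSubfield)) :=
  (exists_ringOfForm_ringEquiv_ringOfIntegers (K : FiniteSubfield) K.2.1).choose_spec

/-- Isomorphic fields have the same orbit. [folklore] -/
theorem orbitOfFieldOfDisc_eq_of_algEquiv {D : ℤ} {K L : cubicSubfieldsOfDisc D}
    (e : (K : FiniteSubfield) ≃ₐ[ℚ] (L : FiniteSubfield)) : orbitOfFieldOfDisc K = orbitOfFieldOfDisc L := by
  obtain ⟨eK⟩ := nonempty_ringEquiv_chosenFormOfDisc K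
  obtain ⟨eL⟩ := nonempty_ringEquiv_chosenFormOfDisc L
  exact gl2zOrbit_eq_iff.mpr (gl2zEquiv_of_ringEquiv_ringOfIntegers_of_ringEquiv eK eL e.toRingEquiv)

/-- The orbit of `K` consists of irreducible forms of discriminant `D`. [folklore] -/
theorem orbitOfFieldOfDisc_mem {D : ℤ} (K : cubicSubfieldsOfDisc D) : orbitOfFieldOfDisc K ∈ irredOrbitsOfDisc D := by
  obtain ⟨eK⟩ := nonempty_ringEquiv_chosenFormOfDisc K
  refine ⟨_, rfl, isIrreducible_of_ringEquiv_ringOfIntegers eK, ?_⟩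
  rw [disc_eq_discr_of_ringEquiv_ringOfIntegers K.2.1 eK]
  exact K.2.2

/-- **The map: isomorphism classes of cubic fields of discriminant `D` → orbits.** [folklore] -/
def orbitOfClassOfDisc {D : ℤ} : CubicFieldClassesOfDisc D → Set (BinaryCubic ℤ) :=
  Quotient.lift orbitOfFieldOfDisc fun _ _ ⟨e⟩ => orbitOfFieldOfDisc_eq_of_algEquiv e

/-- It is injective (equivalent forms have isomorphic maximal orders, hence isomorphic fields). [folklore] -/
theorem orbitOfClassOfDisc_injective {D : ℤ} : Function.Injective (orbitOfClassOfDisc (D := D)) := by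
  intro a b hab
  induction a using Quotient.inductionOn with | h K => ?_
  induction b using Quotient.inductionOn with | h L => ?_
  change orbitOfFieldOfDisc K = orbitOfFieldOfDisc L at hab
  obtain ⟨eK⟩ := nonempty_ringEquiv_chosenFormOfDisc K
  obtain ⟨eL⟩ := nonempty_ringEquiv_chosenFormOfDisc L
  obtain ⟨φ⟩ := nonempty_ringEquiv_of_gl2zEquiv_forms eK eL (gl2zOrbit_eq_iff.mp hab)
  exact Quotient.sound ⟨AlgEquiv.ofRingEquiv (f := φ) fun _ => by simp⟩

/-- Its image lies in `irredOrbitsOfDisc D` (for every `D`). [folklore] -/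
theorem range_orbitOfClassOfDisc_subset (D : ℤ) :
    Set.range (orbitOfClassOfDisc (D := D)) ⊆ irredOrbitsOfDisc D := by
  rintro O ⟨c, rfl⟩
  induction c using Quotient.inductionOn with | h K => ?_
  exact orbitOfFieldOfDisc_mem K

/-- **For FUNDAMENTAL `D` the image is all of `irredOrbitsOfDisc D`**: an irreducible `f` with
`Disc f = D` fundamental has `R(f)` maximal (`isMaximal_of_isFundamental_disc`), so `R(f) ≅ 𝓞 K_f`
for the cubic field `K_f` (`isMaximal_and_isIrreducible_iff`), `Disc K_f = D`, and the orbit of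
`K_f ↪ ℂ` is that of `f`. (Davenport–Heilbronn / BST §8.5: the orbits in `𝒱` of discriminant `D`
are the cubic fields of discriminant `D`.) [cite: BhargavaShankarTsimerman2012, §8.5 (nowhere totally ramified cubic fields ↔ 𝒱)] -/
theorem range_orbitOfClassOfDisc {D : ℤ}
    (hD : (D % 4 = 1 ∧ Squarefree D ∧ D ≠ 1) ∨ (4 ∣ D ∧ (D / 4 % 4 = 2 ∨ D / 4 % 4 = 3) ∧ Squarefree (D / 4))) :
    Set.range (orbitOfClassOfDisc (D := D)) = irredOrbitsOfDisc D := by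
  refine Set.Subset.antisymm (range_orbitOfClassOfDisc_subset D) ?_
  rintro O ⟨f, rfl, hirr, hdisc⟩
  have hmax : IsMaximal f := RingOfForm.isMaximal_of_isFundamental_disc (hdisc ▸ hD)
  obtain ⟨K, _, _, h3, ⟨e⟩⟩ := isMaximal_and_isIrreducible_iff.mp ⟨hmax, hirr⟩
  have hdK : f.disc = discr K := disc_eq_discr_of_ringEquiv_ringOfIntegers h3 e
  obtain ⟨F, hF, ⟨φ⟩⟩ := exists_mem_cubicSubfieldsOfDisc_algEquiv K h3
  rw [← hdK, hdisc] at hF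
  refine ⟨Quotient.mk _ ⟨F, hF⟩, ?_⟩
  change orbitOfFieldOfDisc ⟨F, hF⟩ = gl2zOrbit f
  obtain ⟨eF⟩ := nonempty_ringEquiv_chosenFormOfDisc (⟨F, hF⟩ : cubicSubfieldsOfDisc D)
  exact gl2zOrbit_eq_iff.mpr (gl2zEquiv_of_ringEquiv_ringOfIntegers_of_ringEquiv eF e φ.symm.toRingEquiv)

/-- **(sumh), binary-cubic-form half: for a fundamental discriminant `D`, the number of cubic fields of
discriminant `D` up to isomorphism equals the number of `GL₂(ℤ)`-orbits of irreducible integral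
binary cubic forms of discriminant `D`.** Summed over `0 < ±D < X` fundamental this is
`N(𝒱 ∩ V^{(i)}; X) = Σ_{K₂} #{K₃ : Disc K₃ = Disc K₂}` of BST §8.5.
[cite: BhargavaShankarTsimerman2012, §8.5 (display (sumh), its right-hand side N(𝒱 ∩ V^{(i)}; X))] -/
theorem cubicFieldCountOfDisc_eq_card_irredOrbitsOfDisc {D : ℤ}
    (hD : (D % 4 = 1 ∧ Squarefree D ∧ D ≠ 1) ∨ (4 ∣ D ∧ (D / 4 % 4 = 2 ∨ D / 4 % 4 = 3) ∧ Squarefree (D / 4))) :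
    cubicFieldCountOfDisc D = Nat.card (irredOrbitsOfDisc D) := by
  rw [cubicFieldCountOfDisc, ← Nat.card_range_of_injective (orbitOfClassOfDisc_injective (D := D)),
    range_orbitOfClassOfDisc hD]

/-- The sums over the tree's finsets of fundamental discriminants agree:
`Σ_{D ∈ negFundDiscrs X} cubicFieldCountOfDisc D = Σ_{D ∈ negFundDiscrs X} #irredOrbitsOfDisc D`. [folklore] -/
theorem sum_negFundDiscrs_cubicFieldCountOfDisc_eq (X : ℕ) :
    ∑ D ∈ negFundDiscrs X, cubicFieldCountOfDisc D = ∑ D ∈ negFundDiscrs X, Nat.card (irredOrbitsOfDisc D) :=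
  Finset.sum_congr rfl fun _ hD => cubicFieldCountOfDisc_eq_card_irredOrbitsOfDisc (mem_negFundDiscrs.1 hD).2

/-- … and `Σ_{D ∈ posFundDiscrs X} cubicFieldCountOfDisc D = Σ_{D ∈ posFundDiscrs X} #irredOrbitsOfDisc D`. [folklore] -/
theorem sum_posFundDiscrs_cubicFieldCountOfDisc_eq (X : ℕ) :
    ∑ D ∈ posFundDiscrs X, cubicFieldCountOfDisc D = ∑ D ∈ posFundDiscrs X, Nat.card (irredOrbitsOfDisc D) :=
  Finset.sum_congr rfl fun _ hD => cubicFieldCountOfDisc_eq_card_irredOrbitsOfDisc (mem_posFundDiscrs.1 hD).2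

/-! ### Steps 3–4: the assembly -/

/-- **BST §8.5, last display, with `X` in the denominator**: on finsets `T X` let `t = 2c + 1`
(the dictionary), `(Σ_{T X} c)/X → A` (the orbit count) and `#T X / X → B` (the count of quadratic
fields). Then `(Σ_{T X} t)/X → 2A + B`. [cite: BhargavaShankarTsimerman2012, §8.5 (proof of Cor. 7, last display)] -/
theorem tendsto_sum_div_of_eq_two_mul_add_one {T : ℕ → Finset ℤ} {t c : ℤ → ℕ} {A B : ℝ}
    (htc : ∀ X : ℕ, ∀ D ∈ T X, t D = 2 * c D + 1)
    (hA : Tendsto (fun X : ℕ => (∑ D ∈ T X, (c D : ℝ)) / (X : ℝ)) atTop (𝓝 A))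
    (hB : Tendsto (fun X : ℕ => ((T X).card : ℝ) / (X : ℝ)) atTop (𝓝 B)) :
    Tendsto (fun X : ℕ => (∑ D ∈ T X, (t D : ℝ)) / (X : ℝ)) atTop (𝓝 (2 * A + B)) := by
  have hsum : ∀ X : ℕ, (∑ D ∈ T X, (t D : ℝ)) = 2 * (∑ D ∈ T X, (c D : ℝ)) + ((T X).card : ℝ) := by
    intro X
    rw [Finset.card_eq_sum_ones, Nat.cast_sum, Finset.mul_sum, ← Finset.sum_add_distrib]
    refine Finset.sum_congr rfl fun D hD => ?_
    rw [htc X D hD]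
    push_cast
    ring
  refine ((hA.const_mul 2).add hB).congr fun X => ?_
  rw [hsum X]
  ring

/-- **Davenport–Heilbronn's first-order sums from the dictionary and the count of cubic fields of
fundamental discriminant** (BST §8.5, steps 3–4 of the printed proof, with step 3 PROVED as
`fundDiscrs_card_asymp_holds`): if `#Cl₃(D) = 2·#{cubic fields of disc D} + 1` on fundamental `D`
(`threeTorsion_eq_two_mul_cubicFieldCountOfDisc_add_one`) and
`Σ_{-X<D<0 fund.} #{cubic fields of disc D} / X → 3/(2π²)`,
`Σ_{0<D<X fund.} #{cubic fields of disc D} / X → 1/(2π²)` (`= 3/(nᵢπ²)`, `n₁ = 2`, `n₀ = 6`), then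
`Σ_{-X<D<0} #Cl₃(D) / X → 2·3/(2π²) + 3/π² = 6/π²` and `Σ_{0<D<X} #Cl₃(D) / X → 2·1/(2π²) + 3/π² = 4/π²`,
i.e. `davenportHeilbronn_threeTorsion_sum_asymp`.
[cite: BhargavaShankarTsimerman2012, §8.5 (proof of Cor. 7)] -/
theorem davenportHeilbronn_threeTorsion_sum_asymp_of_cubicFieldCount
    (hdict : ∀ D : ℤ, ((D % 4 = 1 ∧ Squarefree D ∧ D ≠ 1) ∨
      (4 ∣ D ∧ (D / 4 % 4 = 2 ∨ D / 4 % 4 = 3) ∧ Squarefree (D / 4))) →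
      quadFieldThreeTorsion D = 2 * cubicFieldCountOfDisc D + 1)
    (hneg : Tendsto (fun X : ℕ => (∑ D ∈ negFundDiscrs X, (cubicFieldCountOfDisc D : ℝ)) / (X : ℝ))
      atTop (𝓝 (3 / (2 * Real.pi ^ 2))))
    (hpos : Tendsto (fun X : ℕ => (∑ D ∈ posFundDiscrs X, (cubicFieldCountOfDisc D : ℝ)) / (X : ℝ))
      atTop (𝓝 (1 / (2 * Real.pi ^ 2)))) :
    davenportHeilbronn_threeTorsion_sum_asymp := by
  have hπ : (Real.pi ^ 2 : ℝ) ≠ 0 := by positivity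
  constructor
  · have h := tendsto_sum_div_of_eq_two_mul_add_one (T := negFundDiscrs) (t := quadFieldThreeTorsion)
      (c := cubicFieldCountOfDisc) (fun X D hD => hdict D (mem_negFundDiscrs.1 hD).2) hneg
      fundDiscrs_card_asymp_holds.1
    rwa [show 2 * (3 / (2 * Real.pi ^ 2)) + 3 / Real.pi ^ 2 = (6 / Real.pi ^ 2 : ℝ) by
      field_simp; ring] at h
  · have h := tendsto_sum_div_of_eq_two_mul_add_one (T := posFundDiscrs) (t := quadFieldThreeTorsion)
      (c := cubicFieldCountOfDisc) (fun X D hD => hdict D (mem_posFundDiscrs.1 hD).2) hpos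
      fundDiscrs_card_asymp_holds.2
    rwa [show 2 * (1 / (2 * Real.pi ^ 2)) + 3 / Real.pi ^ 2 = (4 / Real.pi ^ 2 : ℝ) by
      field_simp; ring] at h

/-- **The same in BST's own language (§8.5: (sumh) + `lim N(𝒱 ∩ V^{(i)}; X)/X = 3/(nᵢπ²)`)**: if
`#Cl₃(D) = 2·#{cubic fields of disc D} + 1` on fundamental `D` and the number of `GL₂(ℤ)`-orbits of
irreducible integral binary cubic forms with fundamental discriminant in `(−X, 0)`, resp. `(0, X)`,
is `~ 3X/(2π²)`, resp. `~ X/(2π²)` — written as `Σ_{D ∈ negFundDiscrs X} #irredOrbitsOfDisc D`, resp.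
`posFundDiscrs` — then `davenportHeilbronn_threeTorsion_sum_asymp` holds. What remains unproved of the
printed proof is thus exactly: the dictionary (class field theory) and Davenport–Heilbronn's orbit
count (Davenport's theorem with congruence conditions, Prop. 23, and the sieve of §8.3 — the last
being the tree's `DavenportHeilbronnSieve.tendsto_count_iInter_div`).
[cite: BhargavaShankarTsimerman2012, §8.5 (proof of Cor. 7)] -/
theorem davenportHeilbronn_threeTorsion_sum_asymp_of_irredOrbitCount
    (hdict : ∀ D : ℤ, ((D % 4 = 1 ∧ Squarefree D ∧ D ≠ 1) ∨
      (4 ∣ D ∧ (D / 4 % 4 = 2 ∨ D / 4 % 4 = 3) ∧ Squarefree (D / 4))) →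
      quadFieldThreeTorsion D = 2 * cubicFieldCountOfDisc D + 1)
    (hneg : Tendsto (fun X : ℕ => (∑ D ∈ negFundDiscrs X, (Nat.card (irredOrbitsOfDisc D) : ℝ)) / (X : ℝ))
      atTop (𝓝 (3 / (2 * Real.pi ^ 2))))
    (hpos : Tendsto (fun X : ℕ => (∑ D ∈ posFundDiscrs X, (Nat.card (irredOrbitsOfDisc D) : ℝ)) / (X : ℝ))
      atTop (𝓝 (1 / (2 * Real.pi ^ 2)))) :
    davenportHeilbronn_threeTorsion_sum_asymp := by
  have hn : ∀ X : ℕ, (∑ D ∈ negFundDiscrs X, (Nat.card (irredOrbitsOfDisc D) : ℝ)) =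
      ∑ D ∈ negFundDiscrs X, (cubicFieldCountOfDisc D : ℝ) := fun X => by
    exact_mod_cast (sum_negFundDiscrs_cubicFieldCountOfDisc_eq X).symm
  have hp : ∀ X : ℕ, (∑ D ∈ posFundDiscrs X, (Nat.card (irredOrbitsOfDisc D) : ℝ)) =
      ∑ D ∈ posFundDiscrs X, (cubicFieldCountOfDisc D : ℝ) := fun X => by
    exact_mod_cast (sum_posFundDiscrs_cubicFieldCountOfDisc_eq X).symm
  refine davenportHeilbronn_threeTorsion_sum_asymp_of_cubicFieldCount hdict (hneg.congr fun X => ?_)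
    (hpos.congr fun X => ?_)
  · rw [hn X]
  · rw [hp X]

/-! ### Conversely: the fact pins down the counts (consistency of the constants) -/

/-- The last display of §8.5 read backwards, with `X` in the denominator: from `t = 2c + 1` on `T X`,
`(Σ_{T X} t)/X → L` and `#T X / X → B` one gets `(Σ_{T X} c)/X → (L − B)/2`. [cite: BhargavaShankarTsimerman2012, §8.5 (proof of Cor. 7, last display)] -/
theorem tendsto_sum_div_of_eq_two_mul_add_one' {T : ℕ → Finset ℤ} {t c : ℤ → ℕ} {L B : ℝ}
    (htc : ∀ X : ℕ, ∀ D ∈ T X, t D = 2 * c D + 1)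
    (hL : Tendsto (fun X : ℕ => (∑ D ∈ T X, (t D : ℝ)) / (X : ℝ)) atTop (𝓝 L))
    (hB : Tendsto (fun X : ℕ => ((T X).card : ℝ) / (X : ℝ)) atTop (𝓝 B)) :
    Tendsto (fun X : ℕ => (∑ D ∈ T X, (c D : ℝ)) / (X : ℝ)) atTop (𝓝 ((L - B) / 2)) := by
  have hsum : ∀ X : ℕ, (∑ D ∈ T X, (t D : ℝ)) = 2 * (∑ D ∈ T X, (c D : ℝ)) + ((T X).card : ℝ) := by
    intro X
    rw [Finset.card_eq_sum_ones, Nat.cast_sum, Finset.mul_sum, ← Finset.sum_add_distrib]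
    refine Finset.sum_congr rfl fun D hD => ?_
    rw [htc X D hD]
    push_cast
    ring
  refine ((hL.sub hB).div_const 2).congr fun X => ?_
  rw [hsum X]
  ring

/-- **Given the dictionary, `davenportHeilbronn_threeTorsion_sum_asymp` is EQUIVALENT to the two counts
of cubic fields of fundamental discriminant** (`(6/π² − 3/π²)/2 = 3/(2π²)`, `(4/π² − 3/π²)/2 = 1/(2π²)`):
the hypotheses of `davenportHeilbronn_threeTorsion_sum_asymp_of_cubicFieldCount` are exactly as strong as
the fact — BST's (sumh) is an identity, so Cor. 7 and `lim N(𝒱 ∩ V^{(i)}; X)/X = 3/(nᵢπ²)` determine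
each other. [cite: BhargavaShankarTsimerman2012, §8.5 (proof of Cor. 7)] -/
theorem tendsto_cubicFieldCount_div_of_sum_asymp
    (hdict : ∀ D : ℤ, ((D % 4 = 1 ∧ Squarefree D ∧ D ≠ 1) ∨
      (4 ∣ D ∧ (D / 4 % 4 = 2 ∨ D / 4 % 4 = 3) ∧ Squarefree (D / 4))) →
      quadFieldThreeTorsion D = 2 * cubicFieldCountOfDisc D + 1)
    (h : davenportHeilbronn_threeTorsion_sum_asymp) :
    Tendsto (fun X : ℕ => (∑ D ∈ negFundDiscrs X, (cubicFieldCountOfDisc D : ℝ)) / (X : ℝ))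
      atTop (𝓝 (3 / (2 * Real.pi ^ 2))) ∧
    Tendsto (fun X : ℕ => (∑ D ∈ posFundDiscrs X, (cubicFieldCountOfDisc D : ℝ)) / (X : ℝ))
      atTop (𝓝 (1 / (2 * Real.pi ^ 2))) := by
  have hπ : (Real.pi ^ 2 : ℝ) ≠ 0 := by positivity
  constructor
  · have h1 := tendsto_sum_div_of_eq_two_mul_add_one' (T := negFundDiscrs) (t := quadFieldThreeTorsion)
      (c := cubicFieldCountOfDisc) (fun X D hD => hdict D (mem_negFundDiscrs.1 hD).2) h.1
      fundDiscrs_card_asymp_holds.1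
    rwa [show (6 / Real.pi ^ 2 - 3 / Real.pi ^ 2) / 2 = (3 / (2 * Real.pi ^ 2) : ℝ) by
      field_simp; ring] at h1
  · have h2 := tendsto_sum_div_of_eq_two_mul_add_one' (T := posFundDiscrs) (t := quadFieldThreeTorsion)
      (c := cubicFieldCountOfDisc) (fun X D hD => hdict D (mem_posFundDiscrs.1 hD).2) h.2
      fundDiscrs_card_asymp_holds.2
    rwa [show (4 / Real.pi ^ 2 - 3 / Real.pi ^ 2) / 2 = (1 / (2 * Real.pi ^ 2) : ℝ) by
      field_simp; ring] at h2

end Literature.NumberTheory.CubicFields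

end
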